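import Mathlib

/-!
# PneNP / OverlapGapAlgebra — crux `SolvableImpliesStableSection` (stmt-PneNP-2463):
# the MONOTONE REPAIR block (11/·) — extracting a bad walk from a closing clause-walk

Support for crux `stmt-PneNP-2463` (`Summit.PneNP.PneNP.Theses.OverlapGapAlgebra.SolvableImpliesStableSection`):
the f-free block "bounded-round monotone repair gives stable sections up to `α ≤ 2^k/(4k)`".
A CLAUSE-WALK in an instance `Φ` is a clause sequence `W 0, …, W M` with in-slots `U` and out-slots
`O` such that consecutive clauses share a variable at the prescribed slots
(`var(W (d+1), U (d+1)) = var(W d, O d)`), in- and out-slot differ at every clause, and consecutive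
EQUAL clauses use different slots.  A BAD WALK of length `L` from `c` (counted in
`…MonotoneRepairBadCount`) is an injective clause-walk from `c` closed up by one more equation tying the
fresh slot `(W L, O L)` to another slot of the walk.  This file extracts bad walks:

* `sissR_walk_extract` — a clause-walk from `c` with a closing equation at its end contains a bad
  walk from `c` (stop at the first repeated clause: the step into it is the closing equation);
* `sissR_walk_closed` — in particular a clause-walk of length `M ≥ 1` returning to its start does.
Pure combinatorics; no definitions; axioms `propext`, `Classical.choice`, `Quot.sound`.
-/

set_option linter.dupNamespace false -- `Summit.PneNP.PneNP.…`: summit = sub-problem (D-0017)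

namespace Summit.PneNP.PneNP.Theorems

open Finset
open scoped Classical

section WalkExtract

variable {m k n : ℕ}

/-- **Extraction of a bad walk.** Let `W, U, O` be a clause-walk of length `M` in `Φ` (step
equations, in-slot `≠` out-slot at the clauses `1, …, M`, consecutive equal clauses use different
slots) with a closing equation tying `(W M, O M)` to a slot `(W e₀, j₀)` with `e₀ < M`, or `e₀ = M`
and `j₀ ≠ O M`. Then a bad walk of some length `L ≤ M` starts at `W 0`. -/
theorem sissR_walk_extract (Φ : (Fin m → Fin k → Fin n × Bool)) (M : ℕ) (W : ℕ → Fin m) (U O : ℕ → Fin k)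
    (hsteps : ∀ d, d < M → (Φ (W (d + 1)) (U (d + 1))).1 = (Φ (W d) (O d)).1)
    (hio : ∀ i, 1 ≤ i → i ≤ M → U i ≠ O i)
    (hsep : ∀ d, d < M → W (d + 1) = W d → U (d + 1) ≠ O d)
    (e₀ : ℕ) (j₀ : Fin k) (he₀ : e₀ < M ∨ (e₀ = M ∧ j₀ ≠ O M))
    (hclose : (Φ (W M) (O M)).1 = (Φ (W e₀) j₀).1) :
    ∃ L : ℕ, L ≤ M ∧ (∃ (w : ℕ → Fin m) (u o : ℕ → Fin k) (a : ℕ) (j : Fin k),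
        w 0 = (W 0) ∧ a ≤ L ∧ (∀ a' b', a' ≤ L → b' ≤ L → w a' = w b' → a' = b') ∧
        (∀ d, d < L → (Φ (w (d + 1)) (u (d + 1))).1 = (Φ (w d) (o d)).1) ∧
        (L = 0 ∨ o L ≠ u L) ∧ (a < L ∨ j ≠ o L) ∧ (Φ (w L) (o L)).1 = (Φ (w a) j).1) := by
  by_cases hrep : ∃ q, q ≤ M ∧ ∃ e, e < q ∧ W q = W e
  · -- stop at the first repeated clause
    let q₀ := Nat.find hrep
    have hq₀ : q₀ ≤ M ∧ ∃ e, e < q₀ ∧ W q₀ = W e := Nat.find_spec hrep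
    have hmin : ∀ q, q < q₀ → ¬ (q ≤ M ∧ ∃ e, e < q ∧ W q = W e) := fun q hq => Nat.find_min hrep hq
    obtain ⟨hq₀M, e, heq₀, hWe⟩ := hq₀
    have hq₀1 : 1 ≤ q₀ := by omega
    refine ⟨q₀ - 1, by omega, W, U, O, e, U q₀, rfl, by omega, ?_, ?_, ?_, ?_, ?_⟩
    · -- injective before the first repetition
      intro a' b' ha' hb' hab
      by_contra hne
      rcases Nat.lt_or_gt_of_ne hne with h | h
      · exact hmin b' (by omega) ⟨by omega, a', h, hab.symm⟩
      · exact hmin a' (by omega) ⟨by omega, b', h, hab⟩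
    · intro d hd
      exact hsteps d (by omega)
    · rcases Nat.eq_zero_or_pos (q₀ - 1) with h | h
      · exact Or.inl h
      · exact Or.inr (hio (q₀ - 1) h (by omega)).symm
    · by_cases he : e = q₀ - 1
      · right
        have hWW : W (q₀ - 1 + 1) = W (q₀ - 1) := by rw [Nat.sub_add_cancel hq₀1, hWe, he]
        have := hsep (q₀ - 1) (by omega) hWW
        rw [Nat.sub_add_cancel hq₀1] at this
        exact this
      · left; omega
    · have := hsteps (q₀ - 1) (by omega)
      rw [Nat.sub_add_cancel hq₀1, hWe] at this
      exact this.symm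
  · -- no repetition: the walk itself is injective
    push Not at hrep
    refine ⟨M, le_rfl, W, U, O, e₀, j₀, rfl, ?_, ?_, hsteps, ?_, ?_, hclose⟩
    · rcases he₀ with h | ⟨h, _⟩ <;> omega
    · intro a' b' ha' hb' hab
      by_contra hne
      rcases Nat.lt_or_gt_of_ne hne with h | h
      · exact hrep b' hb' a' h hab.symm
      · exact hrep a' ha' b' h hab
    · rcases Nat.eq_zero_or_pos M with h | h
      · exact Or.inl h
      · exact Or.inr (hio M h le_rfl).symm
    · rcases he₀ with h | ⟨_, h⟩
      · exact Or.inl h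
      · exact Or.inr h

/-- **A closed clause-walk contains a bad walk.** A clause-walk of length `M ≥ 1` in `Φ` (step
equations, in-slot `≠` out-slot at the clauses `1, …, M - 1`, consecutive equal clauses use different
slots) that returns to its starting clause contains a bad walk of some length `L ≤ M - 1` from it. -/
theorem sissR_walk_closed (Φ : (Fin m → Fin k → Fin n × Bool)) (M : ℕ) (hM : 1 ≤ M) (W : ℕ → Fin m) (U O : ℕ → Fin k)
    (hsteps : ∀ d, d < M → (Φ (W (d + 1)) (U (d + 1))).1 = (Φ (W d) (O d)).1)
    (hio : ∀ i, 1 ≤ i → i ≤ M - 1 → U i ≠ O i)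
    (hsep : ∀ d, d < M → W (d + 1) = W d → U (d + 1) ≠ O d)
    (hback : W M = W 0) :
    ∃ L : ℕ, L ≤ M - 1 ∧ (∃ (w : ℕ → Fin m) (u o : ℕ → Fin k) (a : ℕ) (j : Fin k),
        w 0 = (W 0) ∧ a ≤ L ∧ (∀ a' b', a' ≤ L → b' ≤ L → w a' = w b' → a' = b') ∧
        (∀ d, d < L → (Φ (w (d + 1)) (u (d + 1))).1 = (Φ (w d) (o d)).1) ∧
        (L = 0 ∨ o L ≠ u L) ∧ (a < L ∨ j ≠ o L) ∧ (Φ (w L) (o L)).1 = (Φ (w a) j).1) := by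
  refine sissR_walk_extract Φ (M - 1) W U O (fun d hd => hsteps d (by omega)) hio
    (fun d hd => hsep d (by omega)) 0 (U M) ?_ ?_
  · rcases Nat.lt_or_ge 0 (M - 1) with h | h
    · exact Or.inl h
    · right
      refine ⟨by omega, ?_⟩
      have hM1 : M = 1 := by omega
      have hWW : W (0 + 1) = W 0 := by rw [Nat.zero_add, ← hM1, hback]
      have := hsep 0 (by omega) hWW
      rw [Nat.zero_add, ← hM1] at this
      rwa [show M - 1 = 0 from h.antisymm (Nat.zero_le _)]
  · have := hsteps (M - 1) (by omega)
    rw [Nat.sub_add_cancel hM, hback] at this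
    exact this.symm

end WalkExtract

end Summit.PneNP.PneNP.Theorems
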